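import Summits.PneNP.PneNP.Theorems.SymmetryBudgetPolylogBarrierWitness
import Summits.PneNP.PneNP.Theorems.SymmetryBudgetPolylogBarrierLower
import Summits.PneNP.PneNP.Theses.SymmetryBudget
import HarnessLib

/-!
# `PolylogBarrier` (route `PneNP/SymmetryBudget`, item stmt-PneNP-2147): the barrier edge of the
# symmetry-budget cliff is a theorem

**`polylogBarrier_proof : PolylogBarrier`.** There is a language `L ∈ P` whose graph slices are
invariant under the budget `Bud(m, ⌊log₂ m⌋²)` — indeed under all of `Sym(Fin m)` — such that for
every polynomial `p`, for infinitely many `m`, no `Bud(m, ⌊log₂ m⌋²)`-symmetric `tcBasis`-circuit of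
size `≤ p(m)` computes the slice `x ↦ [⌜⟨m, Gr x⟩⌝ ∈ L]`.

The witness is NOT the CFI query of the item's informal plan (the tree's polynomial-time CFI
separator `CFISep.cfiSeparatingClass` depends on the vertex order and is not isomorphism-closed, so
its slices are not budget-invariant), but the ISOMORPHISM-CLOSED polynomial-time class
`ParityFP.paritySolvableClass` of graphs whose DEGREE-PARITY SYSTEM over `𝔽₂` is solvable
(`Literature/ModelTheory/FiniteModelTheory/DegreeParitySystem*.lean`), which is fooled by the
Cai–Fürer–Immerman / Atserias–Dawar pairs of encoding graphs of expanding 3XOR systems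
(`XVert.ckEquiv_xgraph`, `exists_parity_hard_pair`). At `m = 2^s` (`⌊log₂ m⌋² = s²`): a
`Bud`-symmetric circuit of size `≤ p(2^s) ≤ 2^{ds}` restricts to a square-symmetric circuit on the
`s² × s²` free block (`CoreReduction.exists_core_circuit`); by the Dawar–Wilsenach support theorem
(`exists_reduced_rigidification_supports`, `k = (d+3)s`, `2^k ≤ C(s², k)`) its gates have supports
of size `≤ k`, so it cannot separate the `≡^{C^{2k+2}}`-equivalent hard pair of order `s²`
(`eval_adjInput_eq_of_ckEquiv`, radius `Ω(s²) ≫ k`) — `no_small_budget_circuit`.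
-/

-- `Summit.PneNP.PneNP.…` duplicates `PneNP` BY DESIGN (single-problem summit).
set_option linter.dupNamespace false

namespace Summit.PneNP.PneNP.Theorems

open Literature.ModelTheory.FiniteModelTheory Literature.Computability.Complexity Filter
open scoped Classical

/-! ### The slices of `L` are invariant under every vertex permutation -/

/-- Relabelling the adjacency matrix by `ρ × ρ` gives an isomorphic graph, hence the same
membership in the degree-parity class. [folklore] -/
theorem parity_slice_invariant (m : ℕ) (ρ : Equiv.Perm (Fin m)) (x : Fin m × Fin m → Bool) :
    encodingGraph.encode ⟨m, SimpleGraph.fromRel fun u v =>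
        (fun q : Fin m × Fin m => x (ρ q.1, ρ q.2)) (u, v) = true⟩ ∈
          graphClassLanguage ParityFP.paritySolvableClass ↔
      encodingGraph.encode ⟨m, SimpleGraph.fromRel fun u v => x (u, v) = true⟩ ∈
        graphClassLanguage ParityFP.paritySolvableClass := by
  rw [encode_mem_graphClassLanguage_iff, encode_mem_graphClassLanguage_iff]
  refine ParityFP.isIsoClosed_paritySolvableClass _ _ ⟨⟨ρ, ?_⟩⟩
  intro a b
  simp only [SimpleGraph.fromRel_adj, ne_eq, ρ.injective.eq_iff]

/-! ### Arithmetic of the scales `m = 2^s`, `g = s²`, `k = (d+3)s`, `n = s²/25` -/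

/-- `s² ≤ 2^s` and `s⁴ ≤ 4^s` from `s = 4` on. [folklore] -/
theorem sq_le_two_pow_and (s : ℕ) (hs : 4 ≤ s) : s ^ 2 ≤ 2 ^ s ∧ s ^ 4 ≤ 4 ^ s := by
  induction s, hs using Nat.le_induction with
  | base => norm_num
  | succ s hs ih =>
    obtain ⟨h1, h2⟩ := ih
    have hsq : (s + 1) ^ 2 ≤ 2 * s ^ 2 := by nlinarith
    constructor
    · calc (s + 1) ^ 2 ≤ 2 * s ^ 2 := hsq
        _ ≤ 2 * 2 ^ s := by omega
        _ = 2 ^ (s + 1) := by ring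
    · calc (s + 1) ^ 4 = ((s + 1) ^ 2) ^ 2 := by ring
        _ ≤ (2 * s ^ 2) ^ 2 := Nat.pow_le_pow_left hsq 2
        _ = 4 * s ^ 4 := by ring
        _ ≤ 4 * 4 ^ s := by omega
        _ = 4 ^ (s + 1) := by ring

/-- Linear is eventually below quadratic (naturals). [folklore] -/
theorem eventually_linear_le_sq (a c : ℕ) : ∀ᶠ s : ℕ in atTop, a * s + c ≤ s ^ 2 := by
  refine eventually_atTop.2 ⟨a + c + 1, fun s hs => ?_⟩
  nlinarith

/-- Linear is eventually below `s²/25 - 1` (reals). [folklore] -/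
theorem eventually_linear_le_sq_real (A B : ℝ) :
    ∀ᶠ s : ℕ in atTop, A * s + B ≤ (s : ℝ) ^ 2 / 25 - 1 := by
  refine eventually_atTop.2 ⟨⌈25 * (|A| + |B| + 1)⌉₊, fun s hs => ?_⟩
  have hs' : 25 * (|A| + |B| + 1) ≤ (s : ℝ) := (Nat.le_ceil _).trans (by exact_mod_cast hs)
  have hA := le_abs_self A
  have hB := le_abs_self B
  have h0 : (0 : ℝ) ≤ |A| := abs_nonneg A
  have h1 : (0 : ℝ) ≤ |B| := abs_nonneg B
  have hs1 : (1 : ℝ) ≤ s := by linarith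
  nlinarith

/-- Natural division by `25`, from below. [folklore] -/
theorem cast_div_ge (a : ℕ) : (a : ℝ) / 25 - 1 ≤ ((a / 25 : ℕ) : ℝ) := by
  have h := Nat.lt_div_mul_add (a := a) (b := 25) (by norm_num)
  have h' : (a : ℝ) < (a / 25 : ℕ) * 25 + 25 := by exact_mod_cast h
  linarith

/-- **All scale conditions hold for large `s`.** Given the exponent `d` (with `p(2^s) + 2 ≤ 2^{ds}`
from `s₀` on), eventually in `s`: `s ≥ s₀`, `s ≥ 4`, the support parameters `k = (d+3)s` satisfy
`k + 1 ≤ s²/4` and `2k ≤ s²`, and the expander parameters of order `n = s²/25` satisfy `3 ≤ n`, the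
threshold of `XorHamGame.exists_boundaryExpander`, and `4 · 3 · (2k+2) ≤ radius n`. [folklore] -/
theorem eventually_scales (d s₀ : ℕ) : ∀ᶠ s : ℕ in atTop, s₀ ≤ s ∧ 4 ≤ s ∧
    ((d + 3) * s + 1) * 4 ≤ s ^ 2 ∧ 2 * ((d + 3) * s) ≤ s ^ 2 ∧ 3 ≤ s ^ 2 / 25 ∧
    32 * (7 / 4) * XorHamGame.cB ^ 4 < ((s ^ 2 / 25 : ℕ) : ℝ) ∧
    4 * (3 * (2 * ((d + 3) * s) + 2)) ≤ XorHamGame.radius (s ^ 2 / 25) := by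
  have c₀pos : (0 : ℝ) < 7 / 4 * (2 * XorHamGame.cB) ^ 4 := by
    have := XorHamGame.cB_pos; positivity
  filter_upwards [eventually_ge_atTop s₀, eventually_ge_atTop 4,
    eventually_linear_le_sq (4 * (d + 3)) 4, eventually_linear_le_sq (2 * (d + 3)) 0,
    eventually_linear_le_sq 0 75,
    eventually_linear_le_sq_real 0 (32 * (7 / 4) * XorHamGame.cB ^ 4 + 1),
    eventually_linear_le_sq_real (7 / 4 * (2 * XorHamGame.cB) ^ 4 * (4 * (3 * (2 * (d + 3)))))
      (7 / 4 * (2 * XorHamGame.cB) ^ 4 * (4 * (3 * 2) + 1))]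
    with s h₀ h4 hk4 hk2 h75 hbig hrad
  have hdiv := cast_div_ge (s ^ 2)
  have hcast : ((s ^ 2 : ℕ) : ℝ) = (s : ℝ) ^ 2 := by push_cast; ring
  rw [hcast] at hdiv
  refine ⟨h₀, h4, by nlinarith, by nlinarith, ?_, ?_, ?_⟩
  · apply Nat.le_div_iff_mul_le (by norm_num) |>.2; nlinarith
  · linarith
  · apply Nat.le_floor
    rw [le_div_iff₀ c₀pos]
    push_cast
    nlinarith

/-! ### The theorem -/

/-- **`PolylogBarrier`** with the inline `let`s of the route statement written out (the witness
`L = graphClassLanguage ParityFP.paritySolvableClass`). [folklore] -/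
theorem polylogBarrier_expanded :
    ∃ L ∈ Classes.P,
      (∀ (m : ℕ), ∀ ρ ∈ ({ρ | ∀ i : Fin m, (i : ℕ) + Nat.log 2 m ^ 2 < m → ρ i = i} :
          Set (Equiv.Perm (Fin m))), ∀ x : Fin m × Fin m → Bool,
        (encodingGraph.encode ⟨m, SimpleGraph.fromRel fun u v =>
            (fun q : Fin m × Fin m => x (ρ q.1, ρ q.2)) (u, v) = true⟩ ∈ L ↔
          encodingGraph.encode ⟨m, SimpleGraph.fromRel fun u v => x (u, v) = true⟩ ∈ L)) ∧
      ∀ p : Polynomial ℕ, ∃ᶠ m in atTop,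
        ¬ ∃ C : Circuit (Fin m × Fin m), C.IsOver tcBasis ∧ C.size ≤ p.eval m ∧
          C.IsSymmetricUnder {ρ | ∀ i : Fin m, (i : ℕ) + Nat.log 2 m ^ 2 < m → ρ i = i} ∧
          C.Computes fun x => decide (encodingGraph.encode
            ⟨m, SimpleGraph.fromRel fun u v => x (u, v) = true⟩ ∈ L) := by
  refine ⟨graphClassLanguage ParityFP.paritySolvableClass,
    ParityFP.isPTIMEClass_paritySolvableClass, fun m ρ _ x => parity_slice_invariant m ρ x,
    fun p => ?_⟩
  obtain ⟨d, g₀, hpow⟩ := CoreReduction.exists_pow_bound p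
  have hev := eventually_scales d g₀
  refine frequently_atTop.2 fun N => ?_
  obtain ⟨s, ⟨h₀, h4, hk4, hk2, hn3, hbig, hrad⟩, hsN⟩ := (hev.and (eventually_ge_atTop N)).exists
  obtain ⟨hsq, hs4⟩ := sq_le_two_pow_and s h4
  refine ⟨2 ^ s, hsN.trans (Nat.lt_two_pow_self).le, ?_⟩
  rw [Nat.log_pow (by norm_num : 1 < 2)]
  obtain ⟨b, hb⟩ : ∃ b, b + s ^ 2 = 2 ^ s := ⟨2 ^ s - s ^ 2, Nat.sub_add_cancel hsq⟩
  rw [← hb]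
  -- the hard pair of order `g = s²`
  obtain ⟨H₁, H₂, hH₁, hH₂, hck⟩ :=
    exists_parity_hard_pair (N := s ^ 2) hn3 hbig (Nat.mul_div_le (s ^ 2) 25)
  refine no_small_budget_circuit (n := b) (g := s ^ 2) (k := (d + 3) * s) (s₀ := p.eval (b + s ^ 2))
    (by nlinarith) (by nlinarith) ((Nat.le_div_iff_mul_le (by norm_num)).2 hk4) ?_
    ⟨H₁, H₂, hH₁, hH₂, hck _ ((Nat.le_div_iff_mul_le (by norm_num)).2 (by linarith))⟩
  -- `p(2^s) + 2 + s⁴ ≤ 2^{ds} + 4^s ≤ 2^{(d+3)s} ≤ C(s², (d+3)s)`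
  rw [hb]
  have h1 : p.eval (2 ^ s) + 2 ≤ 2 ^ (d * s) := hpow s h₀
  have h2 : (s ^ 2) ^ 2 ≤ 4 ^ s := by rw [← pow_mul]; exact hs4
  have h3 : 2 ^ (d * s) + 4 ^ s ≤ 2 ^ ((d + 3) * s) := by
    have e : 2 ^ ((d + 3) * s) = 2 ^ (d * s) * 4 ^ s * 2 ^ s := by
      rw [show (4 : ℕ) = 2 ^ 2 by norm_num, ← pow_mul, ← pow_add, ← pow_add]; ring_nf
    rw [e]
    have ha : 1 ≤ 2 ^ (d * s) := Nat.one_le_two_pow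
    have hb' : 1 ≤ 4 ^ s := Nat.one_le_pow _ _ (by norm_num)
    have hc : 2 ≤ 2 ^ s := by
      calc (2 : ℕ) = 2 ^ 1 := by norm_num
        _ ≤ 2 ^ s := Nat.pow_le_pow_right (by norm_num) (by omega)
    calc 2 ^ (d * s) + 4 ^ s ≤ 2 ^ (d * s) * 4 ^ s + 2 ^ (d * s) * 4 ^ s :=
          add_le_add (Nat.le_mul_of_pos_right _ (by omega)) (Nat.le_mul_of_pos_left _ (by omega))
      _ = 2 ^ (d * s) * 4 ^ s * 2 := by ring
      _ ≤ 2 ^ (d * s) * 4 ^ s * 2 ^ s := Nat.mul_le_mul_left _ hc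
  calc p.eval (2 ^ s) + 2 + (s ^ 2) ^ 2 ≤ 2 ^ (d * s) + 4 ^ s := by omega
    _ ≤ 2 ^ ((d + 3) * s) := h3
    _ ≤ (s ^ 2).choose ((d + 3) * s) := two_pow_le_choose_of_two_mul_le hk2

/-- **The barrier edge of the symmetry-budget cliff** (item stmt-PneNP-2147 of route
`PneNP/SymmetryBudget`, decl `PolylogBarrier`): at budget `g = ⌊log₂ m⌋²` some polynomial-time
language with budget-invariant (indeed fully isomorphism-invariant) graph slices has, for every
polynomial `p`, infinitely often no `Bud(m,g)`-symmetric threshold circuit of size `≤ p(m)` — the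
language of graphs with solvable degree-parity system over `𝔽₂`. [folklore] -/
theorem polylogBarrier_proof : Summit.PneNP.PneNP.Theses.SymmetryBudget.PolylogBarrier :=
  polylogBarrier_expanded

end Summit.PneNP.PneNP.Theorems
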